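import Literature.Computability.Complexity.IWAmpHybrid
import Literature.Computability.Complexity.HammingBallCount
import HarnessLib

/-!
# Density of approximable functions (Hirahara 2022, Lemma 8.1 as a counting statement)

Topic `Computability/Complexity`. The per-variable density bound consumed by the soundness count of
Hirahara's reduction (ECCC TR22-119, Lemma 8.1 "K(f) ≤ K^{Amp^f}_{2^k, 1/2-ε}(Amp^f) + 2ⁿ·(1 - Ω(ε²))",
pp. 26–28, and its use in the proof of Lemma 8.3, p. 29): FEW functions `f : {0,1}ᴺ → {0,1}` have an
amplified padding `y ↦ Amp^f(π y)` that agrees with one of a small family of candidate functions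
`G_p : Y → {0,1}` (`p ∈ Par`) on a `1/2 + η` fraction of `Y ≃ Seed × Suf` — because such an `f` is
`1/4`-close to the MAJORITY VOTE of `≤ C²` advice predictors (`IWAmp.exists_majority_advPred`, the
approximate list decoding of Lemma 8.1), and Hamming balls of radius `2ᴺ/4` are exponentially small
(`HammingBall.card_filter_exists_near_mul_le`).

* `ApproxDensity.exists_suffix` — averaging over the padding `Suf`;
* `ApproxDensity.centre`, `ne_centre_imp_margin_le` — the majority vote of the advice predictors is a
  centre not depending on `f`, and `f` differs from it only where the margin is `≤ 0`;
* `ApproxDensity.card_filter_approx_mul_le` — **the density bound**: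
  `#{f | ∃ p, (1/2+η)|Y| ≤ #{y | G_p y = Amp^f((Φ⁻¹ y).1)}} · 3^{2ᴺ - 2ᴺ/4}
     ≤ |Par| · |Suf| · (C²+1) · |Adv|^{C²} · 4^{2ᴺ}`  (for `kη ≥ 24`, `Cη ≥ 8k`).

## References

* S. Hirahara, *NP-hardness of learning programs and partial MCSP*, ECCC TR22-119, Lemma 8.1 and its
  proof (pp. 26–28; eq. (8) suffix averaging, eq. (10) list decoding), proof of Lemma 8.3 (p. 29)
  [Hirahara2022PartialMCSP].
-/

namespace Literature.Computability.Complexity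

open Finset

namespace ApproxDensity

open IWAmp

variable {N d m k : ℕ} {e : Fin k → (Fin N ↪ Fin d)} {idx : Fin k → Fin m → ZMod 2}

/-- **Averaging over the padding** (Hirahara's eq. (8)): if `G` agrees with `(σ, u) ↦ h σ` on a
`1/2 + η` fraction of `Y ≃ Seed × Suf`, then some slice `G(Φ(·, u))` agrees with `h` on a `1/2 + η`
fraction of `Seed`. [cite: Hirahara2022PartialMCSP, proof of Lemma 8.3, eq. (8) (p. 29)] -/
theorem exists_suffix {S Suf Y : Type} [Fintype S] [Fintype Suf] [Nonempty Suf] [Fintype Y]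
    (Φ : S × Suf ≃ Y) (G : Y → Bool) (h : S → Bool) {η : ℝ}
    (hagree : (1 / 2 + η) * Fintype.card Y ≤ ((univ.filter fun y : Y => G y = h (Φ.symm y).1).card : ℝ)) :
    ∃ u : Suf, (1 / 2 + η) * Fintype.card S ≤
      ((univ.filter fun σ : S => G (Φ (σ, u)) = h σ).card : ℝ) := by
  classical
  by_contra hcon
  push Not at hcon
  -- count through `Φ`
  have hcount : ((univ.filter fun y : Y => G y = h (Φ.symm y).1).card : ℝ) =
      ∑ u : Suf, ((univ.filter fun σ : S => G (Φ (σ, u)) = h σ).card : ℝ) := by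
    have h1 : (univ.filter fun y : Y => G y = h (Φ.symm y).1).card =
        (univ.filter fun q : S × Suf => G (Φ q) = h q.1).card := by
      refine (Finset.card_bij (fun q _ => Φ q) (fun q hq => ?_) (fun a _ b _ hab => Φ.injective hab)
        (fun y hy => ⟨Φ.symm y, ?_, Φ.apply_symm_apply y⟩)).symm
      · rw [mem_filter] at hq ⊢; simpa using hq.2
      · rw [mem_filter] at hy ⊢; simpa using hy.2
    rw [h1]
    have h2 : ((univ.filter fun q : S × Suf => G (Φ q) = h q.1).card : ℝ) =
        ∑ q : S × Suf, if G (Φ q) = h q.1 then (1 : ℝ) else 0 := by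
      simp [Finset.sum_boole]
    rw [h2, Fintype.sum_prod_type, Finset.sum_comm]
    refine sum_congr rfl fun u _ => ?_
    simp [Finset.sum_boole]
  have hY : (Fintype.card Y : ℝ) = Fintype.card S * Fintype.card Suf := by
    rw [← Fintype.card_congr Φ, Fintype.card_prod]; push_cast; ring
  have hlt : ∑ u : Suf, ((univ.filter fun σ : S => G (Φ (σ, u)) = h σ).card : ℝ) <
      ∑ _u : Suf, (1 / 2 + η) * Fintype.card S :=
    Finset.sum_lt_sum_of_nonempty univ_nonempty fun u _ => hcon u
  rw [sum_const, card_univ, nsmul_eq_mul, ← hcount] at hlt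
  have : (1 / 2 + η) * Fintype.card Y < (1 / 2 + η) * Fintype.card Y := by
    calc (1 / 2 + η) * Fintype.card Y ≤ _ := hagree
      _ < Fintype.card Suf * ((1 / 2 + η) * Fintype.card S) := hlt
      _ = (1 / 2 + η) * Fintype.card Y := by rw [hY]; ring
  exact lt_irrefl _ this

/-- **The centre**: the majority vote of the advice predictors `P_{a_j}` (`j < T`) — it does not depend
on `f`. [cite: Hirahara2022PartialMCSP, proof of Lemma 8.1 (via Impagliazzo's hard-core lemma: f is δ-approximated by a majority of weak predictors)] -/
noncomputable def centre (G : Seed N d m → Bool) (C : ℕ) (T : Fin (C ^ 2 + 1)) (advs : Fin (C ^ 2) → Adv e (m := m))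
    (v : Fin N → Bool) : Bool :=
  decide ((T : ℕ) < 2 * ((range T).filter fun j =>
    ∃ h : j < C ^ 2, advPred (idx := idx) (agreeTest G) (advs ⟨j, h⟩) v = true).card)

/-- The predictor sequence of a finite advice list (arbitrary beyond `C²`). [folklore] -/
noncomputable def predSeq (G : Seed N d m → Bool) (C : ℕ) (advs : Fin (C ^ 2) → Adv e (m := m))
    (a₀ : Adv e (m := m)) : ℕ → (Fin N → Bool) → Bool :=
  fun j => advPred (idx := idx) (agreeTest G) (if h : j < C ^ 2 then advs ⟨j, h⟩ else a₀)

/-- **Where `f` differs from the centre, the margin is `≤ 0`.** [cite: Hirahara2022PartialMCSP, proof of Lemma 8.1 (majority vote of the hard-core predictors)] -/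
theorem ne_centre_imp_margin_le (G : Seed N d m → Bool) (C : ℕ) (T : Fin (C ^ 2 + 1))
    (advs : Fin (C ^ 2) → Adv e (m := m)) (a₀ : Adv e (m := m)) (f : (Fin N → Bool) → Bool)
    (v : Fin N → Bool) (hv : f v ≠ centre (idx := idx) G C T advs v) :
    HardCore.margin f (predSeq (idx := idx) G C advs a₀) T v ≤ 0 := by
  classical
  have hT : (T : ℕ) ≤ C ^ 2 := Nat.lt_succ_iff.1 T.isLt
  -- the set of `j < T` voting `true`
  set A := (range T).filter fun j => predSeq (idx := idx) G C advs a₀ j v = true with hA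
  have hAeq : ((range T).filter fun j =>
      ∃ h : j < C ^ 2, advPred (idx := idx) (agreeTest G) (advs ⟨j, h⟩) v = true) = A := by
    rw [hA]
    refine filter_congr fun j hj => ?_
    have hjC : j < C ^ 2 := (mem_range.1 hj).trans_le hT
    simp only [predSeq, dif_pos hjC]
    exact ⟨fun ⟨_, h⟩ => h, fun h => ⟨hjC, h⟩⟩
  have hcentre : centre (idx := idx) G C T advs v = decide ((T : ℕ) < 2 * A.card) := by
    unfold centre; rw [hAeq]
  -- margin = (#true votes) - (#false votes), signed by `f v`
  have hmargin : HardCore.margin f (predSeq (idx := idx) G C advs a₀) T v =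
      ∑ j ∈ range T, (if predSeq (idx := idx) G C advs a₀ j v = f v then (1 : ℤ) else -1) := rfl
  have hsplit : ∑ j ∈ range T, (if predSeq (idx := idx) G C advs a₀ j v = f v then (1 : ℤ) else -1) =
      (if f v = true then 1 else -1) * (2 * (A.card : ℤ) - T) := by
    have hsum : ∑ j ∈ range T, (if predSeq (idx := idx) G C advs a₀ j v = true then (1 : ℤ) else -1) =
        2 * (A.card : ℤ) - T := by
      have h1 : ∀ j, (if predSeq (idx := idx) G C advs a₀ j v = true then (1 : ℤ) else -1) =
          2 * (if predSeq (idx := idx) G C advs a₀ j v = true then (1 : ℤ) else 0) - 1 := fun j => by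
        split_ifs <;> norm_num
      simp_rw [h1, Finset.sum_sub_distrib, ← Finset.mul_sum, Finset.sum_boole, sum_const, card_range]
      simp [hA]
    rcases Bool.eq_false_or_eq_true (f v) with hf | hf
    · rw [hf]; simp only [if_true, one_mul]; exact hsum
    · rw [hf]
      have h2 : ∀ j, (if predSeq (idx := idx) G C advs a₀ j v = false then (1 : ℤ) else -1) =
          -(if predSeq (idx := idx) G C advs a₀ j v = true then (1 : ℤ) else -1) := fun j => by
        cases predSeq (idx := idx) G C advs a₀ j v <;> simp
      simp_rw [h2, Finset.sum_neg_distrib, hsum]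
      simp
  rw [hmargin, hsplit]
  rw [hcentre] at hv
  rcases Bool.eq_false_or_eq_true (f v) with hf | hf
  · rw [hf] at hv ⊢
    have : ¬((T : ℕ) < 2 * A.card) := by
      intro h; exact hv (by rw [decide_eq_true h])
    push Not at this
    have : (2 * (A.card : ℤ) - T) ≤ 0 := by exact_mod_cast (by omega : (2 * (A.card : ℤ) - T : ℤ) ≤ 0)
    simpa using this
  · rw [hf] at hv ⊢
    have : (T : ℕ) < 2 * A.card := by
      by_contra h; exact hv (by rw [decide_eq_false h])
    have : 0 ≤ (2 * (A.card : ℤ) - T) := by omega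
    simp only [Bool.false_eq_true, if_false, neg_mul, one_mul, Left.neg_nonpos_iff]
    exact this

/-- **Density of approximable functions (Lemma 8.1, counting form).** For `k η ≥ 24` and `C η ≥ 8k`
(`δ = 1/4` in `exists_majority_advPred`), the functions `f` whose padded amplification agrees with
some candidate `G_p` on a `1/2 + η` fraction of `Y ≃ Seed × Suf` are `1/4`-close to a centre indexed
by `Par × Suf × [C²+1] × Adv^{C²}`, hence
`#{f | ∃ p, (1/2+η)|Y| ≤ #{y | G_p y = Amp^f((Φ⁻¹y).1)}} · 3^{2ᴺ - 2ᴺ/4} ≤ |Par|·|Suf|·(C²+1)·|Adv|^{C²}·4^{2ᴺ}`.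
[cite: Hirahara2022PartialMCSP, Lemma 8.1 (K(f) ≤ K^{Amp^f}_{2^k,1/2−ε}(Amp^f) + 2ⁿ(1 − Ω(ε²))) and proof of Lemma 8.3 (p. 29)] -/
theorem card_filter_approx_mul_le [NeZero k] (hidx : Function.Injective idx) {η : ℝ} (hη : 0 < η)
    (hkη : 24 ≤ k * η) {C : ℕ} (hCη : 8 * k ≤ C * η) {Suf Y Par : Type} [Fintype Suf] [Nonempty Suf]
    [Fintype Y] [Fintype Par] (Φ : Seed N d m × Suf ≃ Y) (G : Par → Y → Bool) :
    ((univ : Finset ((Fin N → Bool) → Bool)).filter fun f => ∃ p : Par,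
        (1 / 2 + η) * Fintype.card Y ≤
          ((univ.filter fun y : Y => G p y = amp e idx f (Φ.symm y).1).card : ℝ)).card *
        3 ^ (2 ^ N - 2 ^ N / 4) ≤
      Fintype.card Par * Fintype.card Suf * (C ^ 2 + 1) * Fintype.card (Adv e (m := m)) ^ (C ^ 2) *
        4 ^ (2 ^ N) := by
  letI hAdvF : Fintype (Adv e (m := m)) := inferInstance
  have a₀ : Adv e (m := m) := ⟨⟨0, Nat.pos_of_ne_zero (NeZero.ne k)⟩, fun _ => false, ((fun _ => 0), fun _ => 0), false,
    fun _ _ => false⟩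
  -- the centres
  set ctr : Par × Suf × Fin (C ^ 2 + 1) × (Fin (C ^ 2) → Adv e (m := m)) → (Fin N → Bool) → Bool :=
    fun q => centre (idx := idx) (fun σ => G q.1 (Φ (σ, q.2.1))) C q.2.2.1 q.2.2.2 with hctr
  have hV : Fintype.card (Fin N → Bool) = 2 ^ N := by simp
  -- every approximable `f` is near a centre
  have hsub : ((univ : Finset ((Fin N → Bool) → Bool)).filter fun f => ∃ p : Par,
        (1 / 2 + η) * Fintype.card Y ≤
          ((univ.filter fun y : Y => G p y = amp e idx f (Φ.symm y).1).card : ℝ)) ⊆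
      (univ : Finset ((Fin N → Bool) → Bool)).filter fun f =>
        ∃ q, (univ.filter fun v => f v ≠ ctr q v).card ≤ Fintype.card (Fin N → Bool) / 4 := by
    intro f hf
    obtain ⟨p, hp⟩ := (mem_filter.1 hf).2
    obtain ⟨u, hu⟩ := exists_suffix Φ (G p) (amp e idx f) hp
    have hkεδ : 6 ≤ (k : ℝ) * η * (1 / 4) := by linarith
    have hCεδ : 2 * (k : ℝ) ≤ C * η * (1 / 4) := by linarith
    obtain ⟨T, advs, hT, hmaj⟩ := exists_majority_advPred (e := e) (f := f) hidx hη (by norm_num : (0 : ℝ) < 1 / 4)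
      hkεδ hCεδ (fun σ => G p (Φ (σ, u))) hu
    set advsF : Fin (C ^ 2) → Adv e (m := m) := fun j => advs j with hadvsF
    refine mem_filter.2 ⟨mem_univ _, ⟨(p, u, ⟨T, Nat.lt_succ_of_le hT⟩, advsF), ?_⟩⟩
    -- `{f ≠ centre} ⊆ {margin ≤ 0}`
    have hP : ∀ j < T, predSeq (idx := idx) (fun σ => G p (Φ (σ, u))) C advsF a₀ j =
        advPred (idx := idx) (agreeTest fun σ => G p (Φ (σ, u))) (advs j) := by
      intro j hj
      have hjC : j < C ^ 2 := hj.trans_le hT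
      simp [predSeq, hadvsF, dif_pos hjC]
    have hle : (univ.filter fun v => f v ≠ ctr (p, u, ⟨T, Nat.lt_succ_of_le hT⟩, advsF) v).card ≤
        (univ.filter fun v => HardCore.margin f
          (fun j => advPred (idx := idx) (agreeTest fun σ => G p (Φ (σ, u))) (advs j)) T v ≤ 0).card := by
      refine card_le_card fun v hv => ?_
      rw [mem_filter] at hv ⊢
      refine ⟨hv.1, ?_⟩
      have h := ne_centre_imp_margin_le (idx := idx) (fun σ => G p (Φ (σ, u))) C ⟨T, Nat.lt_succ_of_le hT⟩
        advsF a₀ f v hv.2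
      rwa [HardCore.margin_congr f (fun j hj => hP j hj) v] at h
    have hlt : ((univ.filter fun v => f v ≠ ctr (p, u, ⟨T, Nat.lt_succ_of_le hT⟩, advsF) v).card : ℝ) <
        (1 / 4) * Fintype.card (Fin N → Bool) := by
      exact lt_of_le_of_lt (by exact_mod_cast hle) hmaj
    rw [Nat.le_div_iff_mul_le (by norm_num)]
    have : ((univ.filter fun v => f v ≠ ctr (p, u, ⟨T, Nat.lt_succ_of_le hT⟩, advsF) v).card : ℝ) * 4 <
        Fintype.card (Fin N → Bool) := by linarith
    exact_mod_cast this.le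
  have hnear := HammingBall.card_filter_exists_near_mul_le ctr
  have hA : Fintype.card (Par × Suf × Fin (C ^ 2 + 1) × (Fin (C ^ 2) → Adv e (m := m))) =
      Fintype.card Par * Fintype.card Suf * (C ^ 2 + 1) * Fintype.card (Adv e (m := m)) ^ (C ^ 2) := by
    rw [Fintype.card_prod, Fintype.card_prod, Fintype.card_prod, Fintype.card_fin, Fintype.card_pi,
      prod_const, card_univ, Fintype.card_fin]
    ring
  rw [hA, hV] at hnear
  rw [hV] at hsub
  exact le_trans (Nat.mul_le_mul_right _ (card_le_card hsub)) hnear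

end ApproxDensity

end Literature.Computability.Complexity
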